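import Summits.HodgeConjecture.HodgeConjecture.Theorems.H413SpectrumInterfacesKernel
import Summits.HodgeConjecture.HodgeConjecture.Theorems.A3Liu413StubFTF2iffOfFloor
import Summits.HodgeConjecture.HodgeConjecture.Theorems.P2StubU1RealisationAt
import HarnessLib

/-!
# FLOOR-0 P2 — stub U4 `stub_U4_signRule` (the sign rule at the pin) FOLLOWS FROM THE FLOOR ROW IT SERVES, and the line
# `P2ThetaDictionaryExists` closes from U1′ (★) and the SIGNED spectrum statement U2♯ alone

Cell hodgecm-mathlib (D-0151), FLOOR 0, crux item H413 = stmt-HodgeConjecture-24833; programme P2, line of record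
`Cruxes/H413/Lines/P2ThetaDictionaryExists.lean` (A-p18 (g15) v3 8c6e58a8; stubs U1′ :407, U2′ :413, **U4 :418**), shared interfaces
★ `Theorems/H413SpectrumInterfaces{,Kernel}` (modules (A)/(B)).  Author F0P2-p01 (g2) (wave 2 re-seat).  THEOREMS ONLY (no definition, no
instance, no named fact, no `sorry`); `--supports stmt-HodgeConjecture-24833 --as helper`.  HC_CM is proved only modulo the 7 printed
citations until rung 0 closes; this file proves nothing about them.

WHAT IS PROVED (kernel compositions over ★ material).

* §1 `stubU4_of_hdictE : HdictEType → StubU4SignRule` — **the registered stub U4 is a CONSEQUENCE of the floor binder `hdictE`** (the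
  line's own target): at `n = 3`, for a weight-one triple `t` with GLOBAL `ε` whose `ω_V(t)` occurs in the pin's `H¹_{B,τ'}(A_∞, ℂ)`,
  `ω_V(t)` is irreducible (★ `Theorems.isIrreducible_rhoTriple_datum413`, [Liu2021, App. D Lem. D.1 (1)] per place, discharged), hence by
  `hdictE` isomorphic to `ω_V(t')` for an ADMISSIBLE weight-one `t'`; label rigidity on the weight-one family (★
  `Theorems.sep_weightOne_datum413`, [Liu2021, Lem. D.1 (3)] per place + weak approximation) gives `μ_t = μ_{t'}`, `χ_t = χ_{t'}` and
  `ε`-LINES in the same class everywhere; BOTH lines are honest — `t.ε` is global by hypothesis, `t'.ε` by admissibility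
  (`Rep.locF_toFun`, ★ `exists_locF_eq_of_isAdmissible`) — so `ε_t = ε_{t'}`, `t = t'`, and `t` is admissible.  This is B-p14's ★ T4 (⇒)
  argument (`Theorems/A3Liu413StubFTF2iffOfFloor.lean`) re-run under the GLOBAL guard `IsGlobalEps` of U4 in place of the cofinite guard.
* §2 `hdictE_of_admissibleSpectrum : StubU1RealisationAt → U2♯ → HdictEType`, where **U2♯** is the SIGNED form of the registered stub U2′
  (`SpectrumIsThetaAtLevel` with the conclusion `t.IsAdmissible` in place of `IsGlobalEps P t.ε`, written out as an explicit binder type —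
  no definition is introduced): the generic composition ★ `dictionaryExistence_of_parts` with its fourth hypothesis (U4) no longer needed;
  `admissibleSpectrum_to_spectrum : U2♯ → StubU2CohFormsSpectrumIsThetaAt` (★ `isGlobalEps_of_isAdmissible`).
* §3 the heads: `stubU4_of_admissibleSpectrum : U2♯ → StubU4SignRule` (§1 ∘ §2 over ★ U1′ `TowerRealisation.stubU1RealisationAt_holds`,
  p792926), `hdictE_of_admissibleSpectrum_pin : U2♯ → HdictEType`, and `H413_of_admissibleSpectrum : U2♯ → HJ3aType → HoccType →
  HCCMUnconditional.H413` (★ `Hyp413Closing.H413_of_three_facts_flat`) — the crux by name from ONE P2 statement plus P3's and P4's rows.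

READING FOR THE PLANNER.  U4 is not an independent engine fact: `hdictE ⟹ U4` (§1) and `U1′ ∧ U2♯ ⟹ hdictE` (§2), so the P2 line is
`U1′ (★) + U2♯`.  Relative to the adopted detection chain for U2′ (junction ★, (D) `holCotFormSpectralProjection` ∕ `antihol…`, (C)
`Rogawski1990.cohFinComponent_isTheta`, (C′) `rhoAtLine_lineClassTransport`, pin bridge), U2♯ asks for exactly ONE signed letter: (C♯) = (C) with
the extra conjunct `IsAdmissibleElement L (hμ.cmType).1 e` on the line `⟨e⟩` ([Liu2021, proof of Prop. 4.13, l. 2145 first sentence and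
Case 1∕2 l. 2124–2126; Lem. D.2 (2)]; [GR91, Introduction p. 446 L9–11] = [Rogawski1992, Thm. 1.1]) — or, equivalently at the pin, (C) plus a
parity letter E3 read through ★ `Liu2021.isAdmissible_epsOf_iff_even`.  Nothing here chooses between them.

## References
* [Liu2021] Y. Liu, *Fourier–Jacobi cycles and arithmetic relative trace formula*, Camb. J. Math. 9 (2021) = arXiv:2102.11518: Def. 4.11–4.12
  (l. 2083–2108), proof of Prop. 4.13 (l. 2121–2146), Rem. 4.14, Thm. 4.18 (2) with proof l. 2270, App. D Lem. D.1 (1), (3), Lem. D.2 (2).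
* [GelbartRogawski1991] S. Gelbart, J. Rogawski, Invent. Math. 105 (1991), Introduction pp. 446–448, Thm. 5.1.1 p. 465.
* [Rogawski1992] J. Rogawski, *The multiplicity formula for A-packets*, in: The zeta functions of Picard modular surfaces (1992), Thm. 1.1.
* [Rogawski1990] J. Rogawski, Ann. of Math. Stud. 123 (1990), Thm. 13.3.6, Thm. 13.3.7, §14.6.
* [BushnellHenniart2006] §4.3 (Hecke-level rigidity, ★ `HeckeFixedVectorsLift`).  [FlathCorvallis1979] Thm. 3.
-/

set_option autoImplicit false

-- the mandated namespace has the single-problem summit's repeated segment (`HodgeConjecture.HodgeConjecture`)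
set_option linter.dupNamespace false

noncomputable section

namespace Summit.HodgeConjecture.HodgeConjecture.Cruxes.H413.P2StubU4OfDictionary

open scoped TensorProduct Matrix
open NumberField NumberField.InfinitePlace
open HodgeCM.Model HodgeCM.Model.LiuIndex HodgeCM.Model.TowerCarrier
open Summit.HodgeConjecture.CorCM
open Summit.HodgeConjecture.CorCM.Model
open Literature.AlgebraicGeometry.Motives (CMType)
open Literature.AlgebraicGeometry.HodgeTheory Literature.NumberTheory.Automorphic.PicardCM
open Literature.AlgebraicGeometry.ShimuraVarieties Literature.AlgebraicGeometry.ShimuraVarieties.UnitaryCanonicalModel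
open Literature.NumberTheory.ComplexMultiplication
open Literature.NumberTheory.Automorphic
open Literature.NumberTheory.Automorphic.Liu2021 Literature.NumberTheory.Automorphic.Liu2021.AppendixC
open Literature.NumberTheory.Automorphic.Liu2021.Def411WeilCarriers (lineOf locF Rep)
open Summit.HodgeConjecture.CorCM.Transposition.OmegaTransport (realUnit)
open HodgeCM.Model.ArchSideTerm (e₁)
open Literature.NumberTheory.GelbartRogawski1991 Literature.NumberTheory.GelbartRogawski1991.UnitaryDualPair
open Literature.RepresentationTheory Literature.RepresentationTheory.Liu2021
open Summit.HodgeConjecture.CorCM.Transposition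
open Summit.HodgeConjecture.CorCM.Lines.A3Liu413 (datum413)
open Literature.NumberTheory.GelbartRogawski1991.OscillatorTripleDictionary (OccursInH1 IsIsoToOmega rhoTriple)
open Summit.HodgeConjecture.HodgeConjecture.Cruxes.H413.CohFormsCarriers
open Summit.HodgeConjecture.HodgeConjecture.Cruxes.H413.SpectrumInterfaces
open Summit.HodgeConjecture.HodgeConjecture.Theorems (isIrreducible_rhoTriple_datum413 sep_weightOne_datum413 exists_locF_eq_of_isAdmissible)

/-! ## §0  Honest lines: a GLOBAL `ε` is a class family `locF a` -/

set_option synthInstance.maxHeartbeats 400000 in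
set_option maxHeartbeats 8000000 in
/-- **A global `ε` is a class family**: `IsGlobalEps (datum413 …) t.ε` (`ε = epsOf e`, `e ∈ K^{×−}`) gives `ε = locF a` for a unit `a` of `F⁺`
(`Def411WeilCarriers.exists_locF_eq_epsOf`), so the pin's representative section is faithful at `ε` (`Rep.locF_toFun`).
[cite: Liu2021, Def. 4.12 (l. 2102–2108)] -/
theorem exists_locF_eq_of_isGlobalEps
    (hDel : Literature.AlgebraicGeometry.ShimuraVarieties.UnitaryCanonicalModel.canonicalModel_exists_printed)
    (F : HodgeCM.CMField) [IsGalois ℚ F] {ι₁ : F →+* ℂ} (V : HodgeCM.HermSpace3 F ι₁) (a₀ : RealScalar F)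
    (Φ : CMType F) (i : (I V (repAt a₀) (muLiu ι₁ GramClass.rep))) (t : (datum413 hDel F V a₀ Φ i).Triple)
    (hglob : IsGlobalEps (datum413 hDel F V a₀ Φ i) t.ε) :
    ∃ a : (↥(maximalRealSubfield (HodgeCM.CMField.K F)))ˣ,
      locF ↥(maximalRealSubfield (HodgeCM.CMField.K F)) (imagUnitSq (HodgeCM.CMField.K F)) a = t.ε := by
  obtain ⟨x, -, -, hx⟩ := hglob
  obtain ⟨a, ha⟩ := Def411WeilCarriers.exists_locF_eq_epsOf ↥(maximalRealSubfield (HodgeCM.CMField.K F)) (HodgeCM.CMField.K F)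
    (imagUnitSq (HodgeCM.CMField.K F)) (2 * imagUnit (HodgeCM.CMField.K F))⁻¹ x
  exact ⟨a, ha.trans hx⟩

/-! ## §1  U4 from the floor row `hdictE` -/

set_option synthInstance.maxHeartbeats 400000 in
set_option maxHeartbeats 8000000 in
/-- **U4 ⇐ `hdictE` — the sign rule at the pin is a consequence of the floor's dictionary-existence row.**  At `n = 3`, for every `τ'` and
every weight-one triple `t` with GLOBAL `ε` such that `ω_V(t)` occurs in the pin's `H¹_{B,τ'}(A_∞, ℂ)`: `ω_V(t)` is irreducible
(★ `isIrreducible_rhoTriple_datum413`), so `hdictE` gives an ADMISSIBLE weight-one `t'` with `ω_V(t) ≅ ω_V(t')` equivariantly; label rigidity on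
the weight-one family (★ `sep_weightOne_datum413`) identifies `μ`, `χ` and the `ε`-LINES; both lines are honest (`t.ε` global,
`t'.ε` admissible), so `ε_t = ε_{t'}`, `t = t'`, and `ε_t` is `μ_t`-admissible.  (B-p14's ★ T4 (⇒) argument under the global guard.)
[cite: Liu2021, proof of Prop. 4.13, l. 2145; Def. 4.12; Thm. 4.18 (2) with proof l. 2270; App. D Lem. D.1 (1), (3)]
[cite: GelbartRogawski1991, Introduction p. 446 L9–11, p. 448 L30–33; Thm 5.1.1 p. 465] [cite: Rogawski1992, Thm. 1.1] -/
theorem stubU4_of_hdictE (hdictE : HdictEType) : StubU4SignRule := by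
  intro hDel F _ h6 ι₁ V a₀ Φ hΦ i hn τ' t hw hglob hoccω
  -- `ω_V(t)` is irreducible, hence `≅ ω_V(t')` for an admissible weight-one `t'` (floor row III-2 (a)∃ at the pin)
  have hirr : (rhoTriple (datum413 hDel F V a₀ Φ i) t).IsIrreducible :=
    isIrreducible_rhoTriple_datum413 hDel F h6 V a₀ Φ hΦ i t hw
  obtain ⟨t', f, hf⟩ :=
    (hdictEType_iff_datum413.mp hdictE) hDel F h6 V a₀ Φ hΦ i hn τ' _ (rhoTriple (datum413 hDel F V a₀ Φ i) t) hirr hoccω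
  -- label rigidity on the weight-one family: `μ`, the `ε`-LINES and `χ` agree
  obtain ⟨hμ, hlines, hχ⟩ := sep_weightOne_datum413 hDel F h6 V a₀ Φ hΦ i t t'.1 hw t'.2.1 hirr.nontrivial ⟨f, hf⟩
  -- both lines are honest (`ε_t` global, `ε_{t'}` admissible), so the `ε`-labels themselves agree
  have hε : t.ε = t'.1.ε :=
    (((Rep.update ↥(maximalRealSubfield (HodgeCM.CMField.K F)) (imagUnitSq (HodgeCM.CMField.K F)) (Rep.ofLineOf ↥(maximalRealSubfield (HodgeCM.CMField.K F)) (imagUnitSq (HodgeCM.CMField.K F))) (locF ↥(maximalRealSubfield (HodgeCM.CMField.K F)) (imagUnitSq (HodgeCM.CMField.K F)) (realUnit ⟨HodgeCM.CMField.K F⟩ (repAt a₀ (Sigma.fst i)).1 (repAt a₀ (Sigma.fst i)).2.1 (repAt a₀ (Sigma.fst i)).2.2)) (realUnit ⟨HodgeCM.CMField.K F⟩ (repAt a₀ (Sigma.fst i)).1 (repAt a₀ (Sigma.fst i)).2.1 (repAt a₀ (Sigma.fst i)).2.2) rfl).locF_toFun t.ε (exists_locF_eq_of_isGlobalEps hDel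 F V a₀ Φ i t hglob)).symm.trans hlines).trans
      ((Rep.update ↥(maximalRealSubfield (HodgeCM.CMField.K F)) (imagUnitSq (HodgeCM.CMField.K F)) (Rep.ofLineOf ↥(maximalRealSubfield (HodgeCM.CMField.K F)) (imagUnitSq (HodgeCM.CMField.K F))) (locF ↥(maximalRealSubfield (HodgeCM.CMField.K F)) (imagUnitSq (HodgeCM.CMField.K F)) (realUnit ⟨HodgeCM.CMField.K F⟩ (repAt a₀ (Sigma.fst i)).1 (repAt a₀ (Sigma.fst i)).2.1 (repAt a₀ (Sigma.fst i)).2.2)) (realUnit ⟨HodgeCM.CMField.K F⟩ (repAt a₀ (Sigma.fst i)).1 (repAt a₀ (Sigma.fst i)).2.1 (repAt a₀ (Sigma.fst i)).2.2) rfl).locF_toFun t'.1.ε (exists_locF_eq_of_isAdmissible hDel F V a₀ Φ i t'.1 t'.2.2))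
  -- hence `t = t'` is admissible
  have ht : t = t'.1 := by
    obtain ⟨μ₁, h₁, ε₁, χ₁⟩ := t
    obtain ⟨⟨μ₂, h₂, ε₂, χ₂⟩, hw₂⟩ := t'
    dsimp only at hμ hε hχ ⊢
    subst hμ hε hχ
    rfl
  exact ht ▸ t'.2.2

/-! ## §2  `hdictE` from U1′ and the SIGNED spectrum statement U2♯ (no U4) -/

set_option synthInstance.maxHeartbeats 400000 in
set_option maxHeartbeats 8000000 in
/-- **`hdictE` ⇐ U1′ + U2♯.**  U2♯ is the registered stub U2′ (`StubU2CohFormsSpectrumIsThetaAt`, i.e. `SpectrumIsThetaAtLevel (datum413 …) (rightRep F V)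
(cohForms (archFactorOf F V))` at every face) with the SIGNED conclusion `t.IsAdmissible` in place of `IsGlobalEps _ t.ε` — written out as a binder type.  Proof =
★ `dictionaryExistence_of_parts` without its fourth hypothesis: `σ ↪ H¹` occurs in `cohForms 𝔞₀` by U1′ (★ `occursIn_of_realisedIn`); U2♯ gives a compact open `K`
and an ADMISSIBLE weight-one `t` with `σ`, `ω_V(t)` Hecke-related at `K`; Hecke-level rigidity (★ `heckeLevelRigidity_of_omegaIrreducibleOrZero` with
★ `omegaIrreducibleOrZero_datum413` = route item H411; `ε` global by ★ `isGlobalEps_of_isAdmissible`) gives `σ ≅ ω_V(t)`; the witness is `⟨⟨t, hw, hadm⟩, f, hf⟩`.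
[cite: Liu2021, proof of Prop. 4.13, l. 2131–2145; Rem. 4.14] [cite: GelbartRogawski1991, Introduction p. 448 L30–33; Thm 5.1.1 p. 465]
[cite: BushnellHenniart2006, §4.3] -/
theorem hdictE_of_admissibleSpectrum (h1 : StubU1RealisationAt)
    (h2s :
      ∀ (hDel : Literature.AlgebraicGeometry.ShimuraVarieties.UnitaryCanonicalModel.canonicalModel_exists_printed)
        (F : HodgeCM.CMField) [IsGalois ℚ F] (h6 : 6 ≤ Module.finrank ℚ F) {ι₁ : F →+* ℂ} (V : HodgeCM.HermSpace3 F ι₁) (a₀ : RealScalar F)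
        (Φ : CMType F) (hΦ : ι₁ ∈ Φ.1) (i : (I V (repAt a₀) (muLiu ι₁ GramClass.rep))),
      (datum413 hDel F V a₀ Φ i).n = 3 →
        ∀ (W : Type) [AddCommGroup W] [Module ℂ W] (σ : Representation ℂ (datum413 hDel F V a₀ Φ i).G W),
          σ.IsIrreducible → OccursIn (datum413 hDel F V a₀ Φ i) (rightRep F V) (cohForms (archFactorOf F V)) σ →
            ∃ K : Subgroup (datum413 hDel F V a₀ Φ i).G,
              IsOpen (K : Set (datum413 hDel F V a₀ Φ i).G) ∧ IsCompact (K : Set (datum413 hDel F V a₀ Φ i).G) ∧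
                ∃ t : (datum413 hDel F V a₀ Φ i).Triple,
                  t.HasWeightOne ∧ t.IsAdmissible ∧ HeckeRelatedAt K σ (rhoTriple (datum413 hDel F V a₀ Φ i) t)) :
    HdictEType := by
  refine hdictEType_iff_datum413.mpr ?_
  intro hDel F _ h6 ι₁ V a₀ Φ hΦ i hn τ' W _ _ σ hirr hocc
  obtain ⟨K, hKo, hKc, t, hw, hadm, hrel⟩ := h2s hDel F h6 V a₀ Φ hΦ i hn W σ hirr
    (occursIn_of_realisedIn (datum413 hDel F V a₀ Φ i) τ' (rightRep F V) (cohForms (archFactorOf F V))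
      (h1 hDel F h6 V a₀ Φ hΦ i hn τ') σ hocc)
  obtain ⟨f, hf⟩ := heckeLevelRigidity_of_omegaIrreducibleOrZero (datum413 hDel F V a₀ Φ i)
    (omegaIrreducibleOrZero_datum413 hDel F h6 V a₀ Φ hΦ i) W σ hirr t hw
    (isGlobalEps_of_isAdmissible (datum413 hDel F V a₀ Φ i) t hadm) K hKo hKc hrel
  exact ⟨⟨t, hw, hadm⟩, f, hf⟩

set_option synthInstance.maxHeartbeats 400000 in
set_option maxHeartbeats 8000000 in
/-- **U2♯ ⟹ U2′**: the signed spectrum statement implies the registered (unsigned) stub `StubU2CohFormsSpectrumIsThetaAt`, an admissible `ε` being global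
(★ `isGlobalEps_of_isAdmissible`, [Liu2021, Def. 4.12]). [cite: Liu2021, Def. 4.12 (l. 2102–2108)] -/
theorem admissibleSpectrum_to_spectrum
    (h2s :
      ∀ (hDel : Literature.AlgebraicGeometry.ShimuraVarieties.UnitaryCanonicalModel.canonicalModel_exists_printed)
        (F : HodgeCM.CMField) [IsGalois ℚ F] (h6 : 6 ≤ Module.finrank ℚ F) {ι₁ : F →+* ℂ} (V : HodgeCM.HermSpace3 F ι₁) (a₀ : RealScalar F)
        (Φ : CMType F) (hΦ : ι₁ ∈ Φ.1) (i : (I V (repAt a₀) (muLiu ι₁ GramClass.rep))),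
      (datum413 hDel F V a₀ Φ i).n = 3 →
        ∀ (W : Type) [AddCommGroup W] [Module ℂ W] (σ : Representation ℂ (datum413 hDel F V a₀ Φ i).G W),
          σ.IsIrreducible → OccursIn (datum413 hDel F V a₀ Φ i) (rightRep F V) (cohForms (archFactorOf F V)) σ →
            ∃ K : Subgroup (datum413 hDel F V a₀ Φ i).G,
              IsOpen (K : Set (datum413 hDel F V a₀ Φ i).G) ∧ IsCompact (K : Set (datum413 hDel F V a₀ Φ i).G) ∧
                ∃ t : (datum413 hDel F V a₀ Φ i).Triple,
                  t.HasWeightOne ∧ t.IsAdmissible ∧ HeckeRelatedAt K σ (rhoTriple (datum413 hDel F V a₀ Φ i) t)) :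
    StubU2CohFormsSpectrumIsThetaAt := by
  intro hDel F _ h6 ι₁ V a₀ Φ hΦ i hn W _ _ σ hirr hocc
  obtain ⟨K, hKo, hKc, t, hw, hadm, hrel⟩ := h2s hDel F h6 V a₀ Φ hΦ i hn W σ hirr hocc
  exact ⟨K, hKo, hKc, t, hw, isGlobalEps_of_isAdmissible (datum413 hDel F V a₀ Φ i) t hadm, hrel⟩

/-! ## §3  The heads: U4, `hdictE` and the crux `H413` from U2♯ (U1′ is ★ `TowerRealisation.stubU1RealisationAt_holds`) -/

set_option synthInstance.maxHeartbeats 400000 in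
set_option maxHeartbeats 8000000 in
/-- **`hdictE` from U2♯ alone** — U1′ supplied by ★ `TowerRealisation.stubU1RealisationAt_holds` (p792926).
[cite: Liu2021, proof of Prop. 4.13, l. 2145; Rem. 4.14] [cite: GelbartRogawski1991, Introduction p. 448 L30–33; Thm 5.1.1 p. 465] -/
theorem hdictE_of_admissibleSpectrum_pin
    (h2s :
      ∀ (hDel : Literature.AlgebraicGeometry.ShimuraVarieties.UnitaryCanonicalModel.canonicalModel_exists_printed)
        (F : HodgeCM.CMField) [IsGalois ℚ F] (h6 : 6 ≤ Module.finrank ℚ F) {ι₁ : F →+* ℂ} (V : HodgeCM.HermSpace3 F ι₁) (a₀ : RealScalar F)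
        (Φ : CMType F) (hΦ : ι₁ ∈ Φ.1) (i : (I V (repAt a₀) (muLiu ι₁ GramClass.rep))),
      (datum413 hDel F V a₀ Φ i).n = 3 →
        ∀ (W : Type) [AddCommGroup W] [Module ℂ W] (σ : Representation ℂ (datum413 hDel F V a₀ Φ i).G W),
          σ.IsIrreducible → OccursIn (datum413 hDel F V a₀ Φ i) (rightRep F V) (cohForms (archFactorOf F V)) σ →
            ∃ K : Subgroup (datum413 hDel F V a₀ Φ i).G,
              IsOpen (K : Set (datum413 hDel F V a₀ Φ i).G) ∧ IsCompact (K : Set (datum413 hDel F V a₀ Φ i).G) ∧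
                ∃ t : (datum413 hDel F V a₀ Φ i).Triple,
                  t.HasWeightOne ∧ t.IsAdmissible ∧ HeckeRelatedAt K σ (rhoTriple (datum413 hDel F V a₀ Φ i) t)) :
    HdictEType :=
  hdictE_of_admissibleSpectrum TowerRealisation.stubU1RealisationAt_holds h2s

set_option synthInstance.maxHeartbeats 400000 in
set_option maxHeartbeats 8000000 in
/-- **THE REGISTERED STUB U4 `StubU4SignRule` FROM U2♯** (U1′ ★ inside): §1 ∘ §2.  The term a by-name fold `theorem stub_U4_signRule : StubU4SignRule :=
P2StubU4OfDictionary.stubU4_of_admissibleSpectrum ‹U2♯›` consumes once the signed spectrum statement is in the tree.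
[cite: Liu2021, proof of Prop. 4.13, l. 2145; Def. 4.12; Lem. D.2 (2)] [cite: GelbartRogawski1991, Introduction p. 446 L9–11; Thm 5.1.1 p. 465] [cite: Rogawski1992, Thm. 1.1] -/
theorem stubU4_of_admissibleSpectrum
    (h2s :
      ∀ (hDel : Literature.AlgebraicGeometry.ShimuraVarieties.UnitaryCanonicalModel.canonicalModel_exists_printed)
        (F : HodgeCM.CMField) [IsGalois ℚ F] (h6 : 6 ≤ Module.finrank ℚ F) {ι₁ : F →+* ℂ} (V : HodgeCM.HermSpace3 F ι₁) (a₀ : RealScalar F)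
        (Φ : CMType F) (hΦ : ι₁ ∈ Φ.1) (i : (I V (repAt a₀) (muLiu ι₁ GramClass.rep))),
      (datum413 hDel F V a₀ Φ i).n = 3 →
        ∀ (W : Type) [AddCommGroup W] [Module ℂ W] (σ : Representation ℂ (datum413 hDel F V a₀ Φ i).G W),
          σ.IsIrreducible → OccursIn (datum413 hDel F V a₀ Φ i) (rightRep F V) (cohForms (archFactorOf F V)) σ →
            ∃ K : Subgroup (datum413 hDel F V a₀ Φ i).G,
              IsOpen (K : Set (datum413 hDel F V a₀ Φ i).G) ∧ IsCompact (K : Set (datum413 hDel F V a₀ Φ i).G) ∧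
                ∃ t : (datum413 hDel F V a₀ Φ i).Triple,
                  t.HasWeightOne ∧ t.IsAdmissible ∧ HeckeRelatedAt K σ (rhoTriple (datum413 hDel F V a₀ Φ i) t)) :
    StubU4SignRule :=
  stubU4_of_hdictE (hdictE_of_admissibleSpectrum_pin h2s)

set_option synthInstance.maxHeartbeats 400000 in
set_option maxHeartbeats 8000000 in
/-- **THE CRUX `HCCMUnconditional.H413` BY NAME from U2♯ and the other two floor rows** (P3's `hJ3a`, P4's `hocc`), U1′ ★ inside, U4 no longer a hypothesis:
★ `Hyp413Closing.H413_of_three_facts_flat`.  This is the head the line audit of crux item stmt-HodgeConjecture-24833 reads.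
[cite: Liu2021, Prop. 4.13 and proof l. 2121–2146; Rem. 4.14] [cite: GelbartRogawski1991, Introduction p. 448; Thm 5.1.1] [cite: Rogawski1990, Thm. 13.3.1] -/
theorem H413_of_admissibleSpectrum
    (h2s :
      ∀ (hDel : Literature.AlgebraicGeometry.ShimuraVarieties.UnitaryCanonicalModel.canonicalModel_exists_printed)
        (F : HodgeCM.CMField) [IsGalois ℚ F] (h6 : 6 ≤ Module.finrank ℚ F) {ι₁ : F →+* ℂ} (V : HodgeCM.HermSpace3 F ι₁) (a₀ : RealScalar F)
        (Φ : CMType F) (hΦ : ι₁ ∈ Φ.1) (i : (I V (repAt a₀) (muLiu ι₁ GramClass.rep))),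
      (datum413 hDel F V a₀ Φ i).n = 3 →
        ∀ (W : Type) [AddCommGroup W] [Module ℂ W] (σ : Representation ℂ (datum413 hDel F V a₀ Φ i).G W),
          σ.IsIrreducible → OccursIn (datum413 hDel F V a₀ Φ i) (rightRep F V) (cohForms (archFactorOf F V)) σ →
            ∃ K : Subgroup (datum413 hDel F V a₀ Φ i).G,
              IsOpen (K : Set (datum413 hDel F V a₀ Φ i).G) ∧ IsCompact (K : Set (datum413 hDel F V a₀ Φ i).G) ∧
                ∃ t : (datum413 hDel F V a₀ Φ i).Triple,
                  t.HasWeightOne ∧ t.IsAdmissible ∧ HeckeRelatedAt K σ (rhoTriple (datum413 hDel F V a₀ Φ i) t))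
    (hJ3a : HJ3aType) (hocc : HoccType) : Summit.HodgeConjecture.HodgeConjecture.Theses.HCCMUnconditional.H413 :=
  Summit.HodgeConjecture.CorCM.Hyp413Closing.H413_of_three_facts_flat (hdictE_of_admissibleSpectrum_pin h2s) hJ3a hocc

/-- **U4 ⇐ the three registered stubs' own head**: since ★ `oscillatorTriple_dictionaryExistence_holds_of h1 h2 h4 : HdictEType`, §1 returns U4 — recorded only to
certify in the kernel that U4 is EQUIVALENT, given U1′ and U2′, to the floor row (`hdictE ↔ U4` over `U1′ ∧ U2′`). [cite: Liu2021, proof of Prop. 4.13, l. 2145] -/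
theorem hdictE_iff_stubU4 (h1 : StubU1RealisationAt) (h2 : StubU2CohFormsSpectrumIsThetaAt) : HdictEType ↔ StubU4SignRule :=
  ⟨stubU4_of_hdictE, oscillatorTriple_dictionaryExistence_holds_of h1 h2⟩

end Summit.HodgeConjecture.HodgeConjecture.Cruxes.H413.P2StubU4OfDictionary

end
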